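import Summits.BirchSwinnertonDyer.BirchSwinnertonDyer.Theorems.ByReductionTypeAtTwoAdditiveKatoTransport
import Literature.NumberTheory.EllipticCurves.Kato2004.DivisibilityInputsContraExceptionalTransportProofs
import Literature.NumberTheory.EllipticCurves.PAdicLFunctionMinusMultGammaTwist
import HarnessLib

/-!
# Route ByReductionTypeAtTwo, crux `AdditiveRankZeroAtTwo` (stmt-BirchSwinnertonDyer-19098) — the (−2)-BLOCK twin of T20's
# typed input in its PRINT-EXACT home: for `E = E'' ⊗ χ_{−2}` (`E''` split multiplicative at `2`) the `ω·χ₂`-branch package over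
# the dual Selmer datum of key `γ⁻¹`, exceptional prime at Kato's natural `(5T + 6) = (γ − χ₂(γ)κ(γ)⁻¹)`, and the door
# `ℓ_𝔮(X) ≤ ℓ_𝔮(Λ/(L̃))` at EVERY height-one `𝔮 ∌ 2` (one `@[conjecture]` def + theorems; vocabulary
# `padicLFunctionMinusBranchMultTwist`, file `PAdicLFunctionMinusMultGammaTwist`)

Seat `bsd-2adic-addL2x` GEN 16 (sequel of `…AdditiveKatoTransport.lean` p682028 and `…ConventionDefs.lean`). WHY: the landed
input `KatoOddBranchInputsAtTwoNegOneSplitTwist` (and K11b, whose idiom it copies) pairs the covariant `I = 𝐇¹_Γ(T₂W)`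
(`T = conj_γ − 1`) with a key-`γ` dual Selmer datum (contragredient `Λ`-structure), which the cell's print register classifies
as «stronger than print by `ι` AS A PACKAGE» — one crossing map of (17.13.1) is then `Λ`-linear only up to an `ι`-symmetry
(`Literature/…/Kato2004/DivisibilityInputsContragredient.lean`, module docstring). The PRINT-EXACT placement keys the dual
Selmer datum to `γ⁻¹`: then every map of (17.13.1) is `Λ`-linear AS PRINTED (Kato §17.3 «in the natural way», §17.13) and
the local term `𝐇²_loc ≅ ℤ₂(−1)` sits at Kato's natural prime `(γ − κ(γ)⁻¹) = (5T + 4)` (13.13; `κ(γ) = 5`), the Coleman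
image being `≐ 2ⁿ·(5T+4)·L⁻` (T20 (b): Perrin-Riou's `𝔏` has colength one there on the odd branch). This file types THAT
input (`KatoOddBranchInputsAtTwoNegTwoSplitTwistPrintExact`) and proves the corresponding door for the key-`γ⁻¹` datum by the
print-exact kernel twins `Kato2004.MultDivisibilityInputsContra.lengthAt_X_le_{off_factor,at_factor_of_transport}`
(`Kato2004/DivisibilityInputsContraExceptionalTransportProofs.lean`, this GEN). The conclusion transfers to the key-`γ` datum
`D = (D')^ι` by `ℓ_𝔮(D.X) = ℓ_{ι𝔮}(D'.X)` (`Kato2004.lengthAt_eq_of_involSemilinear`, once the twist lemma for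
`SelmerDualData` is in the tree) and the functional equation — the END statements are `ι`-safe.

HONEST FRAMING (cell `bsd-2adic`, D-0036/D-0054): one typed constant (nothing asserted; conjecture-grade at `2`, print at odd
`p` exactly like `Kato2004.exists_multDivisibilityInputs_split_contra`) + conditional theorems; types-the-object-of; closes
none; nothing booked; BSD is not proved by any of this.

References: [Kato2004Asterisque] §12.2 (p. 220), Thm. 12.4 (p. 221), Thm. 12.5 (1)–(3) with (12.5.1) (p. 222), 12.6, 13.13
(pp. 233–234), §16.1, 16.2, 16.6 (pp. 268–271), §17.3 (p. 273), §17.13 (pp. 279–280); [Greenberg1989] pp. 101–102;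
[Kobayashi2006DocMath] Thm. 4.1 (odd p); [GreenbergLNM1716] Thm. 1.14; [MazurTateTeitelbaum1986Invent] §I.10, §I.13, §I.17.
-/

set_option autoImplicit false
-- the summit's namespace `Summit.BirchSwinnertonDyer.BirchSwinnertonDyer` (Sub = Summit) trips `dupNamespace`
set_option linter.dupNamespace false

noncomputable section

open scoped Classical MatrixGroups ModularForm

open Field CongruenceSubgroup WeierstrassCurve Literature.NumberTheory.EllipticCurves
  Literature.NumberTheory.EllipticCurves.ModularForms Literature.NumberTheory.EllipticCurves.IwasawaAlgebra
  Literature.NumberTheory.EllipticCurves.Module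

namespace Summit.BirchSwinnertonDyer.BirchSwinnertonDyer.Theorems.AddKatoTwo

/-! ## §0 The (−2)-block exceptional prime `(5T + 6)` and its conjugate `ι(5T+6) ≐ (T + 6)` are distinct away from `(2)` -/

/-- Numerals under `C : ℤ₂ → Λ`: `C n = n`. [folklore] -/
private theorem C_ofNat_eq' (n : ℕ) [n.AtLeastTwo] :
    (PowerSeries.C (OfNat.ofNat n : ℤ_[2]) : IwasawaAlgebra 2) = (OfNat.ofNat n : IwasawaAlgebra 2) := by
  rw [← Nat.cast_ofNat (R := ℤ_[2]), map_natCast, Nat.cast_ofNat]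

/-- `(1 + T) · ι(5T + 6) = T + 6` in `Λ = ℤ₂⟦T⟧` (`ι T = (1+T)⁻¹ − 1`). [folklore] -/
theorem one_add_X_mul_invol_five_X_add_six :
    (1 + PowerSeries.X : IwasawaAlgebra 2) * invol 2 (PowerSeries.C 5 * PowerSeries.X + PowerSeries.C 6) =
      PowerSeries.X + PowerSeries.C 6 := by
  have h := one_add_X_mul_one_add_invSubOne 2
  rw [map_add, map_mul, invol_X, invol_C, invol_C, C_ofNat_eq' 5, C_ofNat_eq' 6]
  linear_combination (5 : IwasawaAlgebra 2) * h

/-- **`5T + 6` and `ι(5T + 6)` are not both in a prime `𝔮 ∌ 2`**: both memberships give `5T+6, T+6 ∈ 𝔮`, hence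
`5(T+6) − (5T+6) = 24 ∈ 𝔮`, hence `2 ∈ 𝔮` (`AddKatoTwo.C_two_mem_of_twentyfour_mem`). [folklore] -/
theorem not_mem_comap_invol_of_mem_five_X_add_six (𝔮 : PrimeSpectrum (IwasawaAlgebra 2))
    (h2 : PowerSeries.C (2 : ℤ_[2]) ∉ 𝔮.asIdeal) :
    (PowerSeries.C 5 * PowerSeries.X + PowerSeries.C 6 : IwasawaAlgebra 2) ∉ 𝔮.asIdeal ∨
      (PowerSeries.C 5 * PowerSeries.X + PowerSeries.C 6 : IwasawaAlgebra 2) ∉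
        (PrimeSpectrum.comap (invol 2).toRingHom 𝔮).asIdeal := by
  by_contra h
  rw [not_or, not_not, not_not] at h
  obtain ⟨hπ, hιπ⟩ := h
  rw [PrimeSpectrum.comap_asIdeal, Ideal.mem_comap] at hιπ
  change invol 2 (PowerSeries.C 5 * PowerSeries.X + PowerSeries.C 6) ∈ 𝔮.asIdeal at hιπ
  apply h2
  apply C_two_mem_of_twentyfour_mem 𝔮
  have ha : (1 + PowerSeries.X : IwasawaAlgebra 2) *
      invol 2 (PowerSeries.C 5 * PowerSeries.X + PowerSeries.C 6) ∈ 𝔮.asIdeal :=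
    𝔮.asIdeal.mul_mem_left _ hιπ
  rw [one_add_X_mul_invol_five_X_add_six] at ha
  have hb : (PowerSeries.C 5 : IwasawaAlgebra 2) * (PowerSeries.X + PowerSeries.C 6) ∈ 𝔮.asIdeal :=
    𝔮.asIdeal.mul_mem_left _ ha
  have hsum := 𝔮.asIdeal.sub_mem hb hπ
  have h24 : (PowerSeries.C 5 : IwasawaAlgebra 2) * (PowerSeries.X + PowerSeries.C 6) -
      (PowerSeries.C 5 * PowerSeries.X + PowerSeries.C 6) = 24 := by
    rw [C_ofNat_eq' 5, C_ofNat_eq' 6]; ring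
  rwa [h24] at hsum

/-! ## §1 The typed input in its print-exact home -/

/-- [crux input, MEMO — the (−2)-block twin of T20 (b), PRINT-EXACT home] **The `ω·χ₂`-BRANCH §17.13 package at `p = 2` for
an additive curve whose twist by `−2` is split multiplicative at `2`, over the dual Selmer datum of key `γ⁻¹`** (`Kato2004.MultDivisibilityInputsContra`,
the placement in which (17.13.1) is `Λ`-linear as printed against the covariant `𝐇¹_Γ`). For every globally minimal `W/ℚ` with
`W^{(−2)}` split multiplicative at `2` and `W[2]` irreducible, cyclotomic `κ` with generator `γ`, `κ_cyc(γ) = 5`, every newform `f`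
of `W^{(−2)}`, every `I = 𝐇¹_Γ(T₂W)` and every `D' : W.SelmerDualData κ γ⁻¹`: a package for `L = ι(5T+6)·L⁻₂`,
`L⁻₂ = padicLFunctionMinusBranchMultTwist f 1 1 (−1)` (the `ω·χ₂`-branch: `W = W^{(−2)} ⊗ χ_{−2}`, `χ_{−2} = ω χ₂`,
`χ₂(γ) = −1`), whose Coleman map has cokernel of length `0` at every height-one `𝔮 ∌ 2` and whose local term (`= Λ/(γ −
χ₂(γ)κ(γ)⁻¹) = Λ/(5T + 6)` by 13.13: `μ_{2^∞} ⊗ χ_{−2}` is rational over the tower with natural action `(⟨κ⟩χ₂)⁻¹` on the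
dual) has length `0` at every height-one `𝔮 ∌ 2` other than `(5T + 6)`. CONTENT = T20 (b) (Kato 12.4/12.5 (1)–(3)/12.6 for `f_W`; (17.13.1) «exact upto ×2»;
13.13; Thm. 16.2/16.6 for `f_{W^{(−1)}}` with `α = 1`, transported to the odd branch; Coleman clause = odd-branch twin of Kobayashi
2006 Thm. 4.1, printed for odd `p` only — conjecture-grade at `2`, exactly like `Kato2004.exists_multDivisibilityInputs_split_contra`
at `p = 2`). [cite: Kato2004Asterisque, Thm. 12.4 (1) (p. 221), Thm. 12.5 (1)–(3) with (12.5.1) (pp. 221–222), Thm. 12.6 (p. 222), 13.13 (pp. 233–234), §16.1 and Thm. 16.2, 16.6 (pp. 268–271), §17.3 (p. 273), §17.13 (pp. 279–280)]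
[cite: Kobayashi2006DocMath, Thm. 4.1 (odd p)] [cite: Greenberg1989, pp. 101–102 (S^ι)] -/
@[conjecture] def KatoOddBranchInputsAtTwoNegTwoSplitTwistPrintExact : Prop :=
  ∀ (W : WeierstrassCurve ℚ) [W.IsElliptic] [W.IsGloballyMinimal]
    [ContinuousSMul ℤ_[2] (W.tateModule 2)] {N : ℕ} [NeZero N] (f : CuspForm (Gamma0 N) 2)
    (κ : ZpExtension ℚ 2) (γ : absoluteGaloisGroup ℚ),
    (W.quadraticTwist (-2)).HasSplitMultiplicativeReductionAtPrime 2 → W.HasIrreducibleModPGaloisRep 2 →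
    κ.IsCyclotomic → κ.IsTopGenerator γ → IsCyclotomicVariable 2 γ → IsNewformOf (W.quadraticTwist (-2)) f →
    ∀ (I : Kato2004.IwasawaH1Data W 2 κ γ) (D' : W.SelmerDualData κ γ⁻¹),
      ∃ K : Kato2004.MultDivisibilityInputsContra W 2
          (iwasawaToPowerSeries 2 (PowerSeries.C 5 * PowerSeries.X + PowerSeries.C 6) *
            padicLFunctionMinusBranchMultTwist f (1 : ℚ_[2]) 1 (-1)) κ γ I D',
        (∀ 𝔮 : PrimeSpectrum (IwasawaAlgebra 2), 𝔮.asIdeal.height = 1 →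
            PowerSeries.C (2 : ℤ_[2]) ∉ 𝔮.asIdeal →
            Module.lengthAt (IwasawaAlgebra 2) (IwasawaAlgebra 2 ⧸ LinearMap.range K.col) 𝔮 = 0) ∧
        (∀ 𝔮 : PrimeSpectrum (IwasawaAlgebra 2), 𝔮.asIdeal.height = 1 →
            PowerSeries.C (2 : ℤ_[2]) ∉ 𝔮.asIdeal →
            𝔮.asIdeal ≠ Ideal.span {(PowerSeries.C 5 * PowerSeries.X + PowerSeries.C 6 : IwasawaAlgebra 2)} →
            Module.lengthAt (IwasawaAlgebra 2) K.H2loc 𝔮 = 0)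

/-! ## §2 The door for the key-`γ⁻¹` datum -/

/-- **`ℓ_𝔮(X') ≤ ℓ_𝔮(Λ/(L̃))` at EVERY height-one `𝔮 ∌ 2` for the key-`γ⁻¹` dual Selmer datum `D'` of `W` (additive at `2`,
`W^{(−2)}` split multiplicative, `W[2]` irreducible)**, from: `Kato2004.thm12_4`, the print-exact input
`KatoOddBranchInputsAtTwoNegTwoSplitTwistPrintExact`, finite generation of `D'.X` (hypothesis), the symmetry
`ι(char D'.X) = char D'.X` (T20 (a): Greenberg 1.14 ×2 + twist decomposition; used only at `𝔮 ∋ 5T+6`) and the functional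
equation `(ι L̃) = (L̃)` of an integral multiple `L̃ = 2^m L⁻₂ ≠ 0`. Off `(5T+6)` the package alone; at it, transport from
`ι(5T+6) ≐ (T+6)` (the kernel decides: `AddKatoTwo.not_mem_comap_invol_of_mem_five_X_add_six`).
[cite: Kato2004Asterisque, Thm. 12.4 (2) (p. 221), Thm. 12.5 (3) and (12.5.1) (p. 222), Conj. 17.6 (p. 274), §17.13 (pp. 279–280)]
[cite: GreenbergLNM1716, Thm. 1.14 (p. 68)] [cite: MazurTateTeitelbaum1986Invent, §I.17] -/
theorem lengthAt_selmerDualContra_le_of_oddBranchInputsNegTwoPrintExact (h12 : Kato2004.thm12_4)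
    (hPE : KatoOddBranchInputsAtTwoNegTwoSplitTwistPrintExact)
    (W : WeierstrassCurve ℚ) [W.IsElliptic] [W.IsGloballyMinimal] [ContinuousSMul ℤ_[2] (W.tateModule 2)]
    {N : ℕ} [NeZero N] (f : CuspForm (Gamma0 N) 2) (κ : ZpExtension ℚ 2) (γ : absoluteGaloisGroup ℚ)
    (hsp : (W.quadraticTwist (-2)).HasSplitMultiplicativeReductionAtPrime 2)
    (hirr : W.HasIrreducibleModPGaloisRep 2) (hκ : κ.IsCyclotomic) (hγ : κ.IsTopGenerator γ)
    (hγ' : IsCyclotomicVariable 2 γ) (hf : IsNewformOf (W.quadraticTwist (-2)) f)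
    (I : Kato2004.IwasawaH1Data W 2 κ γ) (D' : W.SelmerDualData κ γ⁻¹) [Module.Finite (IwasawaAlgebra 2) D'.X]
    (hXι : (charIdeal (IwasawaAlgebra 2) D'.X).map (invol 2).toRingHom = charIdeal (IwasawaAlgebra 2) D'.X)
    (Lt : IwasawaAlgebra 2) (m : ℕ)
    (hLt : iwasawaToPowerSeries 2 Lt =
      PowerSeries.C ((2 : ℚ_[2]) ^ m) * padicLFunctionMinusBranchMultTwist f (1 : ℚ_[2]) 1 (-1))
    (hLt0 : Lt ≠ 0) (hLtι : (Ideal.span {Lt}).map (invol 2).toRingHom = Ideal.span {Lt})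
    (𝔮 : PrimeSpectrum (IwasawaAlgebra 2)) (h𝔮 : 𝔮.asIdeal.height = 1)
    (hp𝔮 : PowerSeries.C (2 : ℤ_[2]) ∉ 𝔮.asIdeal) :
    lengthAt (IwasawaAlgebra 2) D'.X 𝔮 ≤
      lengthAt (IwasawaAlgebra 2) (IwasawaAlgebra 2 ⧸ Ideal.span {Lt}) 𝔮 := by
  obtain ⟨K, -, -⟩ := hPE W f κ γ hsp hirr hκ hγ hγ' hf I D'
  have hp2 : ((2 : ℕ) : ℚ_[2]) = (2 : ℚ_[2]) := by norm_num
  have hLt' : iwasawaToPowerSeries 2 Lt =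
      PowerSeries.C (((2 : ℕ) : ℚ_[2]) ^ m) * padicLFunctionMinusBranchMultTwist f (1 : ℚ_[2]) 1 (-1) := by
    rw [hp2]; exact hLt
  have hp𝔮' : PowerSeries.C ((2 : ℕ) : ℤ_[2]) ∉ 𝔮.asIdeal := by exact_mod_cast hp𝔮
  rcases not_mem_comap_invol_of_mem_five_X_add_six 𝔮 hp𝔮 with hoff | hat
  · exact K.lengthAt_X_le_off_factor h12 hκ hγ hLt' hLt0 𝔮 h𝔮 hp𝔮' hoff
  · exact K.lengthAt_X_le_at_factor_of_transport h12 hκ hγ hLt' hLt0 𝔮 h𝔮 hp𝔮' hat hXι hLtι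

/-- The LENGTH-form variant at one prime pair: with `ℓ_{𝔮}(D'.X) = ℓ_{ι𝔮}(D'.X)` (e.g. from the decomposition reading by
`lengthAt_selmerDual_symm_of_decomposition`-type bookkeeping) instead of the ideal form; finite generation of `D'.X` not needed.
[cite: Kato2004Asterisque, Thm. 12.5 (3) and (12.5.1) (p. 222), §17.13 (pp. 279–280)] [cite: GreenbergLNM1716, Thm. 1.14 (p. 68)] -/
theorem lengthAt_selmerDualContra_le_of_oddBranchInputsNegTwoPrintExact_of_lengthAt_symm (h12 : Kato2004.thm12_4)
    (hPE : KatoOddBranchInputsAtTwoNegTwoSplitTwistPrintExact)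
    (W : WeierstrassCurve ℚ) [W.IsElliptic] [W.IsGloballyMinimal] [ContinuousSMul ℤ_[2] (W.tateModule 2)]
    {N : ℕ} [NeZero N] (f : CuspForm (Gamma0 N) 2) (κ : ZpExtension ℚ 2) (γ : absoluteGaloisGroup ℚ)
    (hsp : (W.quadraticTwist (-2)).HasSplitMultiplicativeReductionAtPrime 2)
    (hirr : W.HasIrreducibleModPGaloisRep 2) (hκ : κ.IsCyclotomic) (hγ : κ.IsTopGenerator γ)
    (hγ' : IsCyclotomicVariable 2 γ) (hf : IsNewformOf (W.quadraticTwist (-2)) f)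
    (I : Kato2004.IwasawaH1Data W 2 κ γ) (D' : W.SelmerDualData κ γ⁻¹)
    (Lt : IwasawaAlgebra 2) (m : ℕ)
    (hLt : iwasawaToPowerSeries 2 Lt =
      PowerSeries.C ((2 : ℚ_[2]) ^ m) * padicLFunctionMinusBranchMultTwist f (1 : ℚ_[2]) 1 (-1))
    (hLt0 : Lt ≠ 0) (hLtι : (Ideal.span {Lt}).map (invol 2).toRingHom = Ideal.span {Lt})
    (𝔮 : PrimeSpectrum (IwasawaAlgebra 2)) (h𝔮 : 𝔮.asIdeal.height = 1)
    (hp𝔮 : PowerSeries.C (2 : ℤ_[2]) ∉ 𝔮.asIdeal)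
    (hXsym : lengthAt (IwasawaAlgebra 2) D'.X 𝔮 =
      lengthAt (IwasawaAlgebra 2) D'.X (PrimeSpectrum.comap (invol 2).toRingHom 𝔮)) :
    lengthAt (IwasawaAlgebra 2) D'.X 𝔮 ≤
      lengthAt (IwasawaAlgebra 2) (IwasawaAlgebra 2 ⧸ Ideal.span {Lt}) 𝔮 := by
  obtain ⟨K, -, -⟩ := hPE W f κ γ hsp hirr hκ hγ hγ' hf I D'
  have hp2 : ((2 : ℕ) : ℚ_[2]) = (2 : ℚ_[2]) := by norm_num
  have hLt' : iwasawaToPowerSeries 2 Lt =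
      PowerSeries.C (((2 : ℕ) : ℚ_[2]) ^ m) * padicLFunctionMinusBranchMultTwist f (1 : ℚ_[2]) 1 (-1) := by
    rw [hp2]; exact hLt
  have hp𝔮' : PowerSeries.C ((2 : ℕ) : ℤ_[2]) ∉ 𝔮.asIdeal := by exact_mod_cast hp𝔮
  rcases not_mem_comap_invol_of_mem_five_X_add_six 𝔮 hp𝔮 with hoff | hat
  · exact K.lengthAt_X_le_off_factor h12 hκ hγ hLt' hLt0 𝔮 h𝔮 hp𝔮' hoff
  · exact K.lengthAt_X_le_at_factor_of_lengthAt_symm h12 hκ hγ hLt' hLt0 𝔮 h𝔮 hp𝔮' hat hXsym hLtι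

end Summit.BirchSwinnertonDyer.BirchSwinnertonDyer.Theorems.AddKatoTwo

end
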